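import Literature.Analysis.FluidPDE.LocalTypeI
import Literature.Analysis.FluidPDE.ClassicalSolutionRegion
import HarnessLib

/-!
# Barker 2023: localized quantitative regularity under a local `L^∞_t L³_x` bound, and the local
# triple-logarithmic `L³` blow-up rate at a singular point

Topic `Analysis/FluidPDE`. Source: T. Barker, *Localized quantitative estimates and potential
blow-up rates for the Navier–Stokes equations*, SIAM J. Math. Anal. 55 (2023) 5221–5259,
doi:10.1137/22m1527179 = arXiv:2209.15627 [`Barker2023`]; read in the arXiv version (held text
`paper:arxiv-2209.15627`), §1.1 "Main results" (p. 4: **Theorem 1**, **Theorem 2**) and §2.1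
(p. 7: suitable weak solutions in `𝒪 × (T₁,T)` "as described in [Seregin's lecture notes]", the
local energy inequality, singular points `z₀ = (x₀,t₀)`: "`v ∉ L^∞_{x,t}((B(x₀,r) ∩ 𝒪) × (t₀−r²,t₀))`
for all `r > 0` sufficiently small"). One file for §1.1 (D-0064).

## The printed statements (unit viscosity, no force)

* **Theorem 1.** "Suppose that `(v,p)` is a smooth solution to the Navier–Stokes equations on
  `B(0,4) × (−16,0]` and that `(v,p)` is a suitable weak solution on `Q(0,4) := B(0,4) × (−16,0)`.
  Furthermore, suppose that `ℳ ∈ (0,∞)` is such that `‖v‖_{L^∞_t L³_x(Q(0,4))} ≤ ℳ` and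
  `max{ℳ₀, ‖p‖_{L^{3/2}_{x,t}(Q(0,4))}^{3/2}} ≤ ℳ`. Here, `ℳ₀` is a sufficiently large universal
  constant. Then we conclude that
  `‖v‖_{L^∞_{x,t}(B(0,½) × (−e^{−e^{e^{ℳ^{1128}}}}, 0))} ≤ e^{e^{e^{ℳ^{1128}}}}`."
  (It quantifies the local ESŠ criterion — the tree's proved `ess_local_holder`.)
* **Theorem 2.** "Suppose that `(v,p)` is a smooth suitable weak solution to the Navier–Stokes
  equations on `B(0,4) × (0,T*)`. Furthermore suppose that `v ∈ L^∞_{t,loc}([0,T*); L^∞(B(0,4)))`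
  and there exists `x₀ ∈ B(0,4)` such that for all `r ∈ (0, dist(x₀, ∂B(0,4)))`
  `v ∉ L^∞_{x,t}(B(x₀,r) × (T*−r²,T*))`. Then … for all `δ ∈ (0, dist(x₀, ∂B(0,4)))` we have
  `limsup_{t↑T*} ‖v(·,t)‖_{L³(B(x₀,δ))} / (log log log(1/(T*−t)^{1/4}))^{1/1129} = ∞`."
  (The local counterpart of Tao's global rate, the tree's `tao_L3_blowup_rate`.)

## Contents (named facts, D-0014)

* `barker2023_local_quantitative_ess` — Theorem 1.
* `barker2023_local_L3_blowup_rate` — Theorem 2.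

## Transcription notes (never stronger than print)

* *Class.* "Suitable weak solution on `Q(0,4)`" (Seregin's lecture notes, Def. 6.1: global classes
  `v ∈ L_{2,∞}(Q)`, `∇v ∈ L₂(Q)`, `p ∈ L_{3/2}(Q)`, the equations in distributions, the local energy
  inequality) = the tree's Albritton–Barker/Lin class on a parabolic ball,
  `IsSuitableWeakSolutionInBall R z v p` (`LocalTypeI.lean`: `IsSuitableWeakSolutionOn` on the open
  cylinder plus the global classes on it; unit viscosity); "smooth solution on `B × (a,b]`" =
  `IsClassicalNSSolutionOnRegion ((Ioc a b) ×ˢ B) 1 0 v p` (jointly `C^∞`, the equations pointwise,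
  the time derivative taken within the region — one-sided at the top time); in Thm 2 smoothness is
  on the open cylinder. The `L^∞_t L³_x` bound is imposed at every time of the open interval
  (stronger hypothesis); `‖p‖_{L^{3/2}(Q)}^{3/2} = ∫_Q |p|^{3/2}` as a `lintegral`. Since `v` is
  smooth on the region, the printed `L^∞_{x,t}` bound of the conclusion of Thm 1 is the everywhere
  bound on the open window.
* *Thm 2's frame.* Printed on `B(0,4) × (0,T*)` with arbitrary `T* > 0`; recorded on a parabolic ball
  `Q(z₀,R) = (T−R², T) × B(x̄,R)` (the printed configuration is `R = 4`, `T* = 16` after a time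
  translation; conversely any parabolic ball maps onto it by the Navier–Stokes scaling `λ = R/4`, so
  the recorded statement is the printed one read through the scaling — see *Scaling*). The singular
  point `x₀ ∈ B(x̄,R)`: essential unboundedness of `uncurry v` on `parabolicCylinder r (T,x₀)` for
  all `0 < r < R − dist(x₀,x̄)` (= `dist(x₀, ∂B)`; these cylinders lie in `Q(z₀,R)`);
  `v ∈ L^∞_{t,loc}([0,T*); L^∞(B))` = essential boundedness on `(T−R², T') × B(x̄,R)` for every
  `T' < T` (the bottom slice is Lebesgue-null). `limsup = ∞` is recorded as for `tao_L3_blowup_rate`: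
  for every `A`, frequently as `t ↑ T`, `A · (denominator) < ‖v(t)‖_{L³(B(x₀,δ))}` (in `ℝ≥0∞`).
* *Scaling (both theorems, unit viscosity kept).* `w(y,s) = λ v(x̄ + λy, T + λ²s)`, `λ = R/4`, maps a
  solution on `Q((T,x̄),R)` to one on `B(0,4) × (−16,0)`: `‖w(s)‖_{L³(B(0,4))} = ‖v(t)‖_{L³(B(x̄,R))}`,
  `∫_{Q(0,4)} |q|^{3/2} = λ⁻² ∫_{Q(z₀,R)} |p|^{3/2}` (`q = λ²p∘…`), `|w| ≤ K` on
  `B(0,½) × (−τ,0)` iff `|v| ≤ K/λ` on `B(x̄,R/8) × (T − λ²τ, T)`; in Thm 2, `T* − s = (T−t)/λ²`, so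
  the denominator reads `(log log log(1/((16/R²)(T−t))^{1/4}))^{1/1129}`, and `L³` norms on balls
  are invariant. For `R = 4` the recorded statements are literally the printed ones (up to the time
  translation). Viscosity is NOT generalised here (the tree's local suitable class
  `IsSuitableWeakSolutionInBall` is the unit-viscosity class of the local regularity files).
* Not here: Props 1–7, the truncation procedure and the proofs (§§2–5).

## Mathlib / tree search

`lean search 'Barker2023|2209.15627|local_L3_blowup|local_quantitative_ess'`: no transcription
(2026-08-26). Related tree decls: `ess_local_holder` (ESŠ local criterion, proved),
`tao_L3_blowup_rate`, `tao_quantitative_ess` (global quantitative versions),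
`barkerPrange2021_typeI_log_rate` (local rate under a Type I bound). Reused:
`IsSuitableWeakSolutionInBall` (`LocalTypeI.lean`), `IsClassicalNSSolutionOnRegion`
(`ClassicalSolutionRegion.lean`), `parabolicCylinder`. Mathlib has no Navier–Stokes notions.

## References

* T. Barker, SIAM J. Math. Anal. 55 (2023) 5221–5259 = arXiv:2209.15627: §1.1 p. 4 (Thms 1–2),
  §2.1 p. 7. [`Barker2023`]
* L. Escauriaza, G. Seregin, V. Šverák, Russ. Math. Surveys 58 (2003), Thm 1.4 (the tree's
  `ess_local_holder`); T. Tao, PSPM 104 (2021), Thm 1.4 (`tao_L3_blowup_rate`).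
-/

noncomputable section

open MeasureTheory Set Function Metric Filter
open _root_.Topology
open scoped ENNReal

namespace Literature.Analysis.FluidPDE

/-- **Barker 2023, Theorem 1 (localized quantification of the Escauriaza–Seregin–Šverák
criterion).** There is a universal `ℳ₀ > 0` such that for all `ℳ ≥ ℳ₀`, every space–time centre
`z₀ = (T, x̄)` and every `R > 0`: if `(v,p)` is a smooth solution of the unit-viscosity unforced
Navier–Stokes equations on `(T − R², T] × B(x̄,R)` which is a suitable weak solution in the parabolic
ball `Q(z₀,R) = (T − R², T) × B(x̄,R)` (Albritton–Barker/Lin class), with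
`‖v(t)‖_{L³(B(x̄,R))} ≤ ℳ` for all `t ∈ (T − R², T)` and `(16/R²) ∫_{Q(z₀,R)} |p|^{3/2} ≤ ℳ`, then
`|v(t,x)| ≤ (4/R) exp(exp(exp(ℳ^{1128})))` for all `x ∈ B(x̄, R/8)` and all
`t ∈ (T − (R/4)² exp(−exp(exp(ℳ^{1128}))), T)`. Printed at `R = 4`, `z₀ = (0,0)`
(`B(0,4) × (−16,0]`, `‖p‖_{L^{3/2}(Q(0,4))}^{3/2} ≤ ℳ`, conclusion on `B(0,½) × (−e^{−e^{e^{ℳ^{1128}}}},0)`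
with bound `e^{e^{e^{ℳ^{1128}}}}`); general `(z₀,R)` by the Navier–Stokes scaling (module docstring). [cite: Barker2023, Thm. 1 (arXiv:2209.15627 §1.1 p. 4)] -/
def barker2023_local_quantitative_ess : Prop :=
  ∃ M₀ : ℝ, 0 < M₀ ∧ ∀ M : ℝ, M₀ ≤ M →
    ∀ (z₀ : ℝ × EuclideanSpace ℝ (Fin 3)) (R : ℝ), 0 < R →
      ∀ (v : ℝ → EuclideanSpace ℝ (Fin 3) → EuclideanSpace ℝ (Fin 3))
        (p : ℝ → EuclideanSpace ℝ (Fin 3) → ℝ),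
        IsClassicalNSSolutionOnRegion (Ioc (z₀.1 - R ^ 2) z₀.1 ×ˢ ball z₀.2 R) 1 0 v p →
        IsSuitableWeakSolutionInBall R z₀ v p →
        (∀ t ∈ Ioo (z₀.1 - R ^ 2) z₀.1,
          eLpNorm (v t) 3 (volume.restrict (ball z₀.2 R)) ≤ ENNReal.ofReal M) →
        ENNReal.ofReal (16 / R ^ 2) *
            ∫⁻ w in parabolicCylinder R z₀, ‖p w.1 w.2‖ₑ ^ (3 / 2 : ℝ) ≤ ENNReal.ofReal M →
        ∀ t ∈ Ioo (z₀.1 - (R / 4) ^ 2 * Real.exp (-Real.exp (Real.exp (M ^ (1128 : ℕ))))) z₀.1,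
          ∀ x ∈ ball z₀.2 (R / 8),
            ‖v t x‖ ≤ 4 / R * Real.exp (Real.exp (Real.exp (M ^ (1128 : ℕ))))

/-- **Barker 2023, Theorem 2 (local triple-logarithmic `L³` blow-up rate at a singular point).**
For every space–time centre `z₀ = (T, x̄)` and `R > 0`: if `(v,p)` is a smooth solution of the
unit-viscosity unforced Navier–Stokes equations on the open parabolic ball
`Q(z₀,R) = (T − R², T) × B(x̄,R)` which is a suitable weak solution there (Albritton–Barker/Lin
class), essentially bounded on `(T − R², T') × B(x̄,R)` for every `T' < T`, and `x₀ ∈ B(x̄,R)` is a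
singular point at the top time — `uncurry v` essentially unbounded on every backward cylinder
`(T − r², T) × B_r(x₀)`, `0 < r < R − dist(x₀,x̄)` — then for every `0 < δ < R − dist(x₀,x̄)`,
`limsup_{t↑T} ‖v(t)‖_{L³(B(x₀,δ))} / (log log log(1/((16/R²)(T−t))^{1/4}))^{1/1129} = ∞` (recorded:
for every `A`, frequently as `t ↑ T`, `A` times the denominator is `< ‖v(t)‖_{L³(B(x₀,δ))}`).
Printed on `B(0,4) × (0,T*)` with denominator `(log log log(1/(T*−t)^{1/4}))^{1/1129}`; the
parabolic-ball frame and the factor `16/R²` come from the Navier–Stokes scaling `λ = R/4` (module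
docstring; literal for `R = 4`). [cite: Barker2023, Thm. 2 (arXiv:2209.15627 §1.1 p. 4)] -/
def barker2023_local_L3_blowup_rate : Prop :=
  ∀ (z₀ : ℝ × EuclideanSpace ℝ (Fin 3)) (R : ℝ), 0 < R →
    ∀ (v : ℝ → EuclideanSpace ℝ (Fin 3) → EuclideanSpace ℝ (Fin 3))
      (p : ℝ → EuclideanSpace ℝ (Fin 3) → ℝ),
      IsClassicalNSSolutionOnRegion (parabolicCylinder R z₀) 1 0 v p →
      IsSuitableWeakSolutionInBall R z₀ v p →
      (∀ T' : ℝ, z₀.1 - R ^ 2 < T' → T' < z₀.1 →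
        eLpNorm (uncurry v) ∞ (volume.restrict (Ioo (z₀.1 - R ^ 2) T' ×ˢ ball z₀.2 R)) < ∞) →
      ∀ x₀ ∈ ball z₀.2 R,
        (∀ r : ℝ, 0 < r → r < R - dist x₀ z₀.2 →
          eLpNorm (uncurry v) ∞ (volume.restrict (parabolicCylinder r (z₀.1, x₀))) = ∞) →
        ∀ δ : ℝ, 0 < δ → δ < R - dist x₀ z₀.2 →
          ∀ A : ℝ, ∃ᶠ t in 𝓝[<] z₀.1,
            ENNReal.ofReal (A * Real.log (Real.log (Real.log
                (1 / ((16 / R ^ 2) * (z₀.1 - t)) ^ (1 / 4 : ℝ)))) ^ (1 / 1129 : ℝ)) <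
              eLpNorm (v t) 3 (volume.restrict (ball x₀ δ))

end Literature.Analysis.FluidPDE

end
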